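import Summits.FinalStateConjecture.FinalStateConjecture.Theorems.EIHFluxBalanceInertialRecessionStubCoerMomKernelFlatRow
import Summits.FinalStateConjecture.FinalStateConjecture.Theorems.EIHFluxBalanceInertialRecessionStubCoerMomKernelFamily
import Summits.FinalStateConjecture.FinalStateConjecture.Theorems.EIHFluxBalanceInertialRecessionStubCoerMomKernelRegularity
import Summits.FinalStateConjecture.FinalStateConjecture.Theorems.EIHFluxBalanceInertialRecessionStubCoerMomQuantCompact

/-!
# Route EIHFluxBalance — `InertialRecession` (E′), line `SketchCleanExcision`, skeleton r13,
# stub `stub_coerMomKernel` (Bk), analytic half, part 5a: the graded LIMIT — continuity of the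
# rows of the far-field family at zero mass, and the first flat far-field identity

Helper file for the crux `stmt-FinalStateConjecture-17403`
(`Summit.FinalStateConjecture.FinalStateConjecture.Theses.EIHFluxBalance.InertialRecession`, E′),
registered stub `stub_coerMomKernel` (Bk) of skeleton r13 (seat 1, analytic half of Bk).

With `K_ε = boostedKerrBilin L 0 (εM) (εa)`, frame operator `S = Λ⁻¹`, slice point `x` with
`r_0(Sx) > 0`, and `row_ε(A', d') = Ric(K_ε + x⁰Var_{(1,εa,A',d')})(x)(♯dx⁰, e) − Ric(K_ε)(x)(♯dx⁰, e)`: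

* `bk_row_eq_ricciJet_field` — the row of `G + x⁰Φ` through `MetricCoord.ricciJet` for ANY
  smooth symmetric `Φ` (the special case `Φ = Var` is `coerMomQ_row_eq_ricciJet`);
* `bk_continuousAt_row`, `bk_row_zero` — **`ε ↦ row_ε(A', d')` is continuous at `ε = 0`**, with
  value the row of the flat model `η + x⁰Var_{(1,0,A',d')}` (continuity of the row functional on
  jets, `coerMomQ_continuousAt_rowFun`; joint smoothness of the family, part 4; `K_0 = η`);
* `bk_step_one` — from the scaled identity (part 3): the flat row of `Var_{(1,0,A,0)}` vanishes
  (step two, the spin/translation row, is part 5b `…StubCoerMomKernelStepTwo`).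

No definitions, no named facts, no `sorry`.
-/

set_option linter.dupNamespace false
set_option maxSynthPendingDepth 3

noncomputable section

open Set Function Filter ContinuousLinearMap Literature.Geometry.Lorentzian
  Literature.Geometry.Lorentzian.MetricCoord
open scoped Topology ContDiff

namespace Summit.FinalStateConjecture.FinalStateConjecture.Theorems.SublinearIsFree.Slaving

/-! ### The row through the Ricci jet function, for a general modulating field -/

set_option maxHeartbeats 1600000 in
/-- **The momentum row of `G + x⁰Φ` through the Ricci jet function**, for any field `Φ` smooth
with symmetric values on an open `U ∋ x` (`x⁰ = 0`, `G` metric components near `x`).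
[cite: ONeill1983, Ch. 3, Lemma 3.52] -/
theorem bk_row_eq_ricciJet_field {G Φ : E4 → E4 →L[ℝ] E4 →L[ℝ] ℝ} {V U : Set E4} {x : E4}
    (hG : IsMetricOn G V) (hxV : x ∈ V) (hx0 : x 0 = 0) (hU : IsOpen U)
    (hΦc : ContDiffOn ℝ ∞ Φ U) (hxU : x ∈ U) (hΦs : ∀ z ∈ U, ∀ v w : E4, Φ z v w = Φ z w v) (e : E4) :
    (ricAt (fun z : E4 ↦ G z + (z 0) • Φ z) x (sharpAt G x (E4.dx 0)) e
        - ricAt G x (sharpAt G x (E4.dx 0)) e)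
      = ricciJet (x, G x, fderiv ℝ G x + (E4.dx 0).smulRight (Φ x),
          fderiv ℝ (fderiv ℝ G) x + ((E4.dx 0).smulRight (fderiv ℝ Φ x)
            + (ContinuousLinearMap.smulRightL ℝ E4 (E4 →L[ℝ] E4 →L[ℝ] ℝ) (E4.dx 0)).comp
              (fderiv ℝ Φ x))) (sharpAt G x (E4.dx 0)) e
        - ricciJet (x, G x, fderiv ℝ G x, fderiv ℝ (fderiv ℝ G) x) (sharpAt G x (E4.dx 0)) e := by
  obtain ⟨V', hV'o, hxV', -, hV'U, hG', hG₁⟩ :=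
    coerMomQ_isMetricOn_add_slice_smul hG hxV hx0 hΦc hU hxU hΦs
  obtain ⟨-, h11, h12⟩ := coerMomQ_jets_add_slice_smul hG'.contDiffOn (hΦc.mono hV'U) hV'o hxV' hx0
  have h12' := coerMomQ_jet₂_shift_eq h12
  have e1 : ricAt (fun z : E4 ↦ G z + (z 0) • Φ z) x = ricciJet (x, G x,
      fderiv ℝ G x + (E4.dx 0).smulRight (Φ x),
      fderiv ℝ (fderiv ℝ G) x + ((E4.dx 0).smulRight (fderiv ℝ Φ x)
        + (ContinuousLinearMap.smulRightL ℝ E4 (E4 →L[ℝ] E4 →L[ℝ] ℝ) (E4.dx 0)).comp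
          (fderiv ℝ Φ x))) := by
    rw [ricAt_eq_ricciJet hG₁ hxV', h11, h12', hx0, zero_smul, add_zero]
  have e2 : ricAt G x = ricciJet (x, G x, fderiv ℝ G x, fderiv ℝ (fderiv ℝ G) x) :=
    ricAt_eq_ricciJet hG' hxV'
  rw [e1, e2]

/-! ### Continuity of the rows of the far-field family at zero mass -/

set_option maxHeartbeats 3200000 in
/-- **The rows of the far-field family are continuous at `ε = 0`.** For the painted family
`K_ε = boostedKerrBilin L 0 (εM) (εa)` and a fixed motion `(A', d')`, the row
`row_ε(A', d') = Ric(K_ε + x⁰Var_{(1,εa,A',d')})(x)(♯_{K_ε}dx⁰, e) − Ric(K_ε)(x)(♯_{K_ε}dx⁰, e)` at a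
slice point `x` (`x⁰ = 0`, `r_0(Sx) > 0`) is a continuous function of `ε` at `0`: it is the
continuous row functional on jets (`coerMomQ_continuousAt_rowFun`) evaluated on the 2-jet of
`K_ε` and the 1-jet of `Var_{(1,εa,A',d')}` at `x`, which depend smoothly on `ε`
(`bk_contDiffAt_family₂`, `bk_contDiffAt_var₂`). [folklore] -/
theorem bk_continuousAt_row (L : lorentzGroup) (M a : ℝ) (A' : E4 →L[ℝ] E4) (d' : E4) {x : E4}
    (hx0 : x 0 = 0) (hx : 0 < Kerr.radius 0 (((L : E4 ≃L[ℝ] E4).symm : E4 →L[ℝ] E4) x)) (e : E4) :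
    ContinuousAt (fun ε : ℝ ↦
      ricAt (fun z : E4 ↦ boostedKerrBilin L 0 (ε * M) (ε * a) z + (z 0) • ((fderiv ℝ (Kerr.bilin 1 (ε * a)) (((L : E4 ≃L[ℝ] E4).symm : E4 →L[ℝ] E4) z) (A' (((L : E4 ≃L[ℝ] E4).symm : E4 →L[ℝ] E4) z) + d')).bilinearComp ((L : E4 ≃L[ℝ] E4).symm : E4 →L[ℝ] E4) ((L : E4 ≃L[ℝ] E4).symm : E4 →L[ℝ] E4) + (Kerr.bilin 1 (ε * a) (((L : E4 ≃L[ℝ] E4).symm : E4 →L[ℝ] E4) z)).bilinearComp (A'.comp ((L : E4 ≃L[ℝ] E4).symm : E4 →L[ℝ] E4)) ((L : E4 ≃L[ℝ] E4).symm : E4 →L[ℝ] E4) + (Kerr.bilin 1 (ε * a) (((L : E4 ≃L[ℝ] E4).symm : E4 →L[ℝ] E4) z)).bilinearComp ((L : E4 ≃L[ℝ] E4).symm : E4 →L[ℝ] E4) (A'.comp ((L : E4 ≃L[ℝ] E4).symm : E4 →L[ℝ] E4)))) x (sharpAt (boostedKerrBilin L 0 (ε * M) (ε * a)) x (E4.dx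 0)) e
        - ricAt (boostedKerrBilin L 0 (ε * M) (ε * a)) x (sharpAt (boostedKerrBilin L 0 (ε * M) (ε * a)) x (E4.dx 0)) e) 0 := by
  set S : E4 →L[ℝ] E4 := ((L : E4 ≃L[ℝ] E4).symm : E4 →L[ℝ] E4) with hS
  -- the family and the first-variation field as functions of the parameters
  obtain ⟨KSf, hKSf⟩ : ∃ KSf : ℝ → E4 → E4 →L[ℝ] E4 →L[ℝ] ℝ,
      KSf = fun ε z ↦ (Kerr.bilin (ε * M) (ε * a) (S z)).bilinearComp S S := ⟨_, rfl⟩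
  obtain ⟨Vf, hVf⟩ : ∃ Vf : ℝ → E4 → E4 →L[ℝ] E4 →L[ℝ] ℝ,
      Vf = fun a' z ↦ ((fderiv ℝ (Kerr.bilin 1 a') (S z) (A' (S z) + d')).bilinearComp S S + (Kerr.bilin 1 a' (S z)).bilinearComp (A'.comp S) S + (Kerr.bilin 1 a' (S z)).bilinearComp S (A'.comp S)) := ⟨_, rfl⟩
  have hKf : ∀ ε : ℝ, boostedKerrBilin L 0 (ε * M) (ε * a) = KSf ε := fun ε ↦ by
    rw [hKSf, coerMomQ_boostedKerrBilin_eq_frame]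
  -- the row functional on jets
  obtain ⟨R, hR⟩ : ∃ R : (E4 × (E4 →L[ℝ] E4 →L[ℝ] ℝ) × (E4 →L[ℝ] E4 →L[ℝ] E4 →L[ℝ] ℝ)
      × (E4 →L[ℝ] E4 →L[ℝ] E4 →L[ℝ] E4 →L[ℝ] ℝ))
      × ((E4 →L[ℝ] E4 →L[ℝ] ℝ) × (E4 →L[ℝ] E4 →L[ℝ] E4 →L[ℝ] ℝ)) → ℝ,
      R = fun w ↦ ricciJet (w.1.1, w.1.2.1, w.1.2.2.1 + (E4.dx 0).smulRight w.2.1,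
          w.1.2.2.2 + ((E4.dx 0).smulRight w.2.2
            + (ContinuousLinearMap.smulRightL ℝ E4 (E4 →L[ℝ] E4 →L[ℝ] ℝ) (E4.dx 0)).comp w.2.2))
          (w.1.2.1.inverse (E4.dx 0)) e
        - ricciJet w.1 (w.1.2.1.inverse (E4.dx 0)) e := ⟨_, rfl⟩
  -- the data map
  obtain ⟨D, hD⟩ : ∃ D : ℝ → (E4 × (E4 →L[ℝ] E4 →L[ℝ] ℝ) × (E4 →L[ℝ] E4 →L[ℝ] E4 →L[ℝ] ℝ)
      × (E4 →L[ℝ] E4 →L[ℝ] E4 →L[ℝ] E4 →L[ℝ] ℝ))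
      × ((E4 →L[ℝ] E4 →L[ℝ] ℝ) × (E4 →L[ℝ] E4 →L[ℝ] E4 →L[ℝ] ℝ)),
      D = fun ε ↦ ((x, KSf ε x, fderiv ℝ (KSf ε) x, fderiv ℝ (fderiv ℝ (KSf ε)) x),
        (Vf (ε * a) x, fderiv ℝ (Vf (ε * a)) x)) := ⟨_, rfl⟩
  -- the row equals `R ∘ D` wherever the painted radius `r_{εa}(Sx)` is positive
  have key : ∀ ε : ℝ, 0 < Kerr.radius (ε * a) (S x) →
      (ricAt (fun z : E4 ↦ KSf ε z + (z 0) • Vf (ε * a) z) x (sharpAt (KSf ε) x (E4.dx 0)) e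
        - ricAt (KSf ε) x (sharpAt (KSf ε) x (E4.dx 0)) e) = R (D ε) := by
    intro ε hε
    have hKm : IsMetricOn (KSf ε) (poincareInv L 0 ⁻¹' (Kerr.region (ε * a) 0 : Set E4)) := by
      rw [← hKf]; exact bk_isMetricOn_boostedKerrBilin L (ε * M) (ε * a)
    have hxK : x ∈ poincareInv L 0 ⁻¹' (Kerr.region (ε * a) 0 : Set E4) := (bk_mem_region_iff L _ x).2 hε
    have h := coerMomQ_row_eq_ricciJet hKm hxK hx0 1 (ε * a) S A' d' hε e
    rw [hR, hD, hVf]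
    exact h
  -- positivity of the painted radius near `ε = 0`
  have hrad0 : 0 < Kerr.radius (0 * a) (S x) := by rwa [zero_mul]
  have hev : ∀ᶠ ε : ℝ in 𝓝 0, 0 < Kerr.radius (ε * a) (S x) := by
    have hca : Tendsto (fun ε : ℝ ↦ ε * a) (𝓝 0) (𝓝 0) := by
      have h := (tendsto_id (x := 𝓝 (0 : ℝ))).mul_const a
      rw [zero_mul] at h
      exact h
    exact hca.eventually (Kerr.eventually_radius_pos hx)
  -- smooth dependence of the data on `ε`
  have hP : ContDiffAt ℝ ∞ (uncurry KSf) (0, x) := by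
    rw [hKSf]; exact bk_contDiffAt_family₂ M a S (q₀ := ((0 : ℝ), x)) hrad0
  obtain ⟨cK0, cK1, cK2⟩ := coerMomQ_contDiffAt_jets_param hP
  have hV : ContDiffAt ℝ ∞ (uncurry Vf) (0, x) := by
    rw [hVf]; exact bk_contDiffAt_var₂ 1 S A' d' (q₀ := ((0 : ℝ), x)) hx
  obtain ⟨cV0, cV1, -⟩ := coerMomQ_contDiffAt_jets_param hV
  have hca : ContinuousAt (fun ε : ℝ ↦ ε * a) 0 :=
    (continuous_id.mul continuous_const : Continuous fun ε : ℝ ↦ ε * a).continuousAt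
  have cV0' : ContinuousAt (fun ε : ℝ ↦ Vf (ε * a) x) 0 :=
    ContinuousAt.comp (g := fun a' : ℝ ↦ Vf a' x) (f := fun ε : ℝ ↦ ε * a) (x := 0)
      (by rw [zero_mul]; exact cV0.continuousAt) hca
  have cV1' : ContinuousAt (fun ε : ℝ ↦ fderiv ℝ (Vf (ε * a)) x) 0 :=
    ContinuousAt.comp (g := fun a' : ℝ ↦ fderiv ℝ (Vf a') x) (f := fun ε : ℝ ↦ ε * a) (x := 0)
      (by rw [zero_mul]; exact cV1.continuousAt) hca
  have hDc : ContinuousAt D 0 := by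
    rw [hD]
    exact (continuousAt_const.prodMk (cK0.continuousAt.prodMk
      (cK1.continuousAt.prodMk cK2.continuousAt))).prodMk (cV0'.prodMk cV1')
  -- continuity of `R` at `D 0` (the value `KSf 0 x = η` is invertible)
  have hK0 : KSf 0 = fun _ : E4 ↦ Minkowski.bilin := by
    rw [← hKf 0, zero_mul, zero_mul, bk_boostedKerrBilin_zero_mass]
  have hinv : (D 0).1.2.1.IsInvertible := by
    rw [hD]
    show (KSf 0 x).IsInvertible
    rw [hK0]
    exact isInvertible_of_nondegenerate Minkowski.bilin_nondegenerate
  have hRc : ContinuousAt R (D 0) := by rw [hR]; exact coerMomQ_continuousAt_rowFun e hinv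
  have hcomp : ContinuousAt (fun ε ↦ R (D ε)) 0 := ContinuousAt.comp (g := R) hRc hDc
  -- conclude by the eventual identity
  have hev' : (fun ε : ℝ ↦
      ricAt (fun z : E4 ↦ boostedKerrBilin L 0 (ε * M) (ε * a) z + (z 0) • ((fderiv ℝ (Kerr.bilin 1 (ε * a)) (S z) (A' (S z) + d')).bilinearComp S S + (Kerr.bilin 1 (ε * a) (S z)).bilinearComp (A'.comp S) S + (Kerr.bilin 1 (ε * a) (S z)).bilinearComp S (A'.comp S))) x (sharpAt (boostedKerrBilin L 0 (ε * M) (ε * a)) x (E4.dx 0)) e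
        - ricAt (boostedKerrBilin L 0 (ε * M) (ε * a)) x (sharpAt (boostedKerrBilin L 0 (ε * M) (ε * a)) x (E4.dx 0)) e)
      =ᶠ[𝓝 0] fun ε ↦ R (D ε) := by
    filter_upwards [hev] with ε hε
    rw [← key ε hε, hKf ε, hVf]
  exact hcomp.congr_of_eventuallyEq hev'

/-- **The row of the far-field family at `ε = 0`** is the row of the flat model
`η + x⁰Var_{(1,0,A',d')}` (`K_0 = η`, `Ric η = 0`). [folklore] -/
theorem bk_row_zero (L : lorentzGroup) (M a : ℝ) (A' : E4 →L[ℝ] E4) (d' : E4) (x e : E4) :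
    (ricAt (fun z : E4 ↦ boostedKerrBilin L 0 (0 * M) (0 * a) z + (z 0) • ((fderiv ℝ (Kerr.bilin 1 (0 * a)) (((L : E4 ≃L[ℝ] E4).symm : E4 →L[ℝ] E4) z) (A' (((L : E4 ≃L[ℝ] E4).symm : E4 →L[ℝ] E4) z) + d')).bilinearComp ((L : E4 ≃L[ℝ] E4).symm : E4 →L[ℝ] E4) ((L : E4 ≃L[ℝ] E4).symm : E4 →L[ℝ] E4) + (Kerr.bilin 1 (0 * a) (((L : E4 ≃L[ℝ] E4).symm : E4 →L[ℝ] E4) z)).bilinearComp (A'.comp ((L : E4 ≃L[ℝ] E4).symm : E4 →L[ℝ] E4)) ((L : E4 ≃L[ℝ] E4).symm : E4 →L[ℝ] E4) + (Kerr.bilin 1 (0 * a) (((L : E4 ≃L[ℝ] E4).symm : E4 →L[ℝ] E4) z)).bilinearComp ((L : E4 ≃L[ℝ] E4).symm : E4 →L[ℝ] E4) (A'.comp ((L : E4 ≃L[ℝ] E4).symm : E4 →L[ℝ] E4)))) x (sharpAt (boostedKerrBilin L 0 (0 * M) (0 * a)) x (E4.dx 0)) e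
        - ricAt (boostedKerrBilin L 0 (0 * M) (0 * a)) x (sharpAt (boostedKerrBilin L 0 (0 * M) (0 * a)) x (E4.dx 0)) e)
      = ricAt (fun z : E4 ↦ Minkowski.bilin + (z 0) • ((fderiv ℝ (Kerr.bilin 1 0) (((L : E4 ≃L[ℝ] E4).symm : E4 →L[ℝ] E4) z) (A' (((L : E4 ≃L[ℝ] E4).symm : E4 →L[ℝ] E4) z) + d')).bilinearComp ((L : E4 ≃L[ℝ] E4).symm : E4 →L[ℝ] E4) ((L : E4 ≃L[ℝ] E4).symm : E4 →L[ℝ] E4) + (Kerr.bilin 1 0 (((L : E4 ≃L[ℝ] E4).symm : E4 →L[ℝ] E4) z)).bilinearComp (A'.comp ((L : E4 ≃L[ℝ] E4).symm : E4 →L[ℝ] E4)) ((L : E4 ≃L[ℝ] E4).symm : E4 →L[ℝ] E4) + (Kerr.bilin 1 0 (((L : E4 ≃L[ℝ] E4).symm : E4 →L[ℝ] E4) z)).bilinearComp ((L : E4 ≃L[ℝ] E4).symm : E4 →L[ℝ] E4) (A'.comp ((L : E4 ≃L[ℝ] E4).symm : E4 →L[ℝ] E4)))) x (sharpAt (fun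 _ : E4 ↦ Minkowski.bilin) x (E4.dx 0)) e := by
  have hK0 : boostedKerrBilin L 0 (0 * M) (0 * a) = fun _ : E4 ↦ Minkowski.bilin := by
    rw [zero_mul, zero_mul, bk_boostedKerrBilin_zero_mass]
  rw [hK0]
  simp only [zero_mul, ricAt_constMetric, _root_.zero_apply, sub_zero]

/-! ### Step one: the flat row of the first variation vanishes -/

set_option maxHeartbeats 1600000 in
/-- **Step one of the graded limit.** From the scaled identity
`row_ε(A, 0) + ε · row_ε(0, d) = 0` for small `ε > 0` (part 3) and the continuity of both rows at
`ε = 0` (`bk_continuousAt_row`): `row_0(A, 0) = 0`, i.e. the momentum row of the flat model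
`η + x⁰Var_{(1,0,A,0)}` vanishes at `x`. [folklore] -/
theorem bk_step_one (L : lorentzGroup) (M a : ℝ) (A : E4 →L[ℝ] E4) (d : E4) {x : E4}
    (hx0 : x 0 = 0) (hx : 0 < Kerr.radius 0 (((L : E4 ≃L[ℝ] E4).symm : E4 →L[ℝ] E4) x)) {e : E4}
    (hid : ∃ ε₀ : ℝ, 0 < ε₀ ∧ ∀ ε : ℝ, 0 < ε → ε < ε₀ →
      (ricAt (fun z : E4 ↦ boostedKerrBilin L 0 (ε * M) (ε * a) z + (z 0) • ((fderiv ℝ (Kerr.bilin 1 (ε * a)) (((L : E4 ≃L[ℝ] E4).symm : E4 →L[ℝ] E4) z) (A (((L : E4 ≃L[ℝ] E4).symm : E4 →L[ℝ] E4) z) + 0)).bilinearComp ((L : E4 ≃L[ℝ] E4).symm : E4 →L[ℝ] E4) ((L : E4 ≃L[ℝ] E4).symm : E4 →L[ℝ] E4) + (Kerr.bilin 1 (ε * a) (((L : E4 ≃L[ℝ] E4).symm : E4 →L[ℝ] E4) z)).bilinearComp (A.comp ((L : E4 ≃L[ℝ] E4).symm : E4 →L[ℝ] E4)) ((L : E4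 ≃L[ℝ] E4).symm : E4 →L[ℝ] E4) + (Kerr.bilin 1 (ε * a) (((L : E4 ≃L[ℝ] E4).symm : E4 →L[ℝ] E4) z)).bilinearComp ((L : E4 ≃L[ℝ] E4).symm : E4 →L[ℝ] E4) (A.comp ((L : E4 ≃L[ℝ] E4).symm : E4 →L[ℝ] E4)))) x (sharpAt (boostedKerrBilin L 0 (ε * M) (ε * a)) x (E4.dx 0)) e
          - ricAt (boostedKerrBilin L 0 (ε * M) (ε * a)) x (sharpAt (boostedKerrBilin L 0 (ε * M) (ε * a)) x (E4.dx 0)) e)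
        + ε * (ricAt (fun z : E4 ↦ boostedKerrBilin L 0 (ε * M) (ε * a) z + (z 0) • ((fderiv ℝ (Kerr.bilin 1 (ε * a)) (((L : E4 ≃L[ℝ] E4).symm : E4 →L[ℝ] E4) z) ((0 : E4 →L[ℝ] E4) (((L : E4 ≃L[ℝ] E4).symm : E4 →L[ℝ] E4) z) + d)).bilinearComp ((L : E4 ≃L[ℝ] E4).symm : E4 →L[ℝ] E4) ((L : E4 ≃L[ℝ] E4).symm : E4 →L[ℝ] E4) + (Kerr.bilin 1 (ε * a) (((L : E4 ≃L[ℝ] E4).symm : E4 →L[ℝ] E4) z)).bilinearComp ((0 : E4 →L[ℝ] E4).comp ((L : E4 ≃L[ℝ] E4).symm : E4 →L[ℝ] E4)) ((L : E4 ≃L[ℝ] E4).symm : E4 →L[ℝ] E4) + (Kerr.bilin 1 (ε * a) (((L : E4 ≃L[ℝ] E4).symm : E4 →L[ℝ] E4) z)).bilinearComp ((L : E4 ≃L[ℝ] E4).symm : E4 →L[ℝ] E4) ((0 : E4 →L[ℝ] E4).comp ((L : E4 ≃L[ℝ] E4).symm : E4 →L[ℝ] E4)))) x (sharpAt (boostedKerrBilin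 L 0 (ε * M) (ε * a)) x (E4.dx 0)) e
          - ricAt (boostedKerrBilin L 0 (ε * M) (ε * a)) x (sharpAt (boostedKerrBilin L 0 (ε * M) (ε * a)) x (E4.dx 0)) e) = 0) :
    ricAt (fun z : E4 ↦ Minkowski.bilin + (z 0) • ((fderiv ℝ (Kerr.bilin 1 0) (((L : E4 ≃L[ℝ] E4).symm : E4 →L[ℝ] E4) z) (A (((L : E4 ≃L[ℝ] E4).symm : E4 →L[ℝ] E4) z) + 0)).bilinearComp ((L : E4 ≃L[ℝ] E4).symm : E4 →L[ℝ] E4) ((L : E4 ≃L[ℝ] E4).symm : E4 →L[ℝ] E4) + (Kerr.bilin 1 0 (((L : E4 ≃L[ℝ] E4).symm : E4 →L[ℝ] E4) z)).bilinearComp (A.comp ((L : E4 ≃L[ℝ] E4).symm : E4 →L[ℝ] E4)) ((L : E4 ≃L[ℝ] E4).symm : E4 →L[ℝ] E4) + (Kerr.bilin 1 0 (((L : E4 ≃L[ℝ] E4).symm : E4 →L[ℝ] E4) z)).bilinearComp ((L : E4 ≃L[ℝ] E4).symm : E4 →L[ℝ] E4) (A.comp ((L : E4 ≃L[ℝ]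 E4).symm : E4 →L[ℝ] E4)))) x (sharpAt (fun _ : E4 ↦ Minkowski.bilin) x (E4.dx 0)) e = 0 := by
  set S : E4 →L[ℝ] E4 := ((L : E4 ≃L[ℝ] E4).symm : E4 →L[ℝ] E4) with hS
  obtain ⟨ε₀, hε₀, hid⟩ := hid
  -- the two rows as functions of `ε`
  obtain ⟨ΦA, hΦA⟩ : ∃ f : ℝ → ℝ, f = fun ε : ℝ ↦
      ricAt (fun z : E4 ↦ boostedKerrBilin L 0 (ε * M) (ε * a) z + (z 0) • ((fderiv ℝ (Kerr.bilin 1 (ε * a)) (S z) (A (S z) + 0)).bilinearComp S S + (Kerr.bilin 1 (ε * a) (S z)).bilinearComp (A.comp S) S + (Kerr.bilin 1 (ε * a) (S z)).bilinearComp S (A.comp S))) x (sharpAt (boostedKerrBilin L 0 (ε * M) (ε * a)) x (E4.dx 0)) e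
        - ricAt (boostedKerrBilin L 0 (ε * M) (ε * a)) x (sharpAt (boostedKerrBilin L 0 (ε * M) (ε * a)) x (E4.dx 0)) e := ⟨_, rfl⟩
  obtain ⟨Φd, hΦd⟩ : ∃ f : ℝ → ℝ, f = fun ε : ℝ ↦
      ricAt (fun z : E4 ↦ boostedKerrBilin L 0 (ε * M) (ε * a) z + (z 0) • ((fderiv ℝ (Kerr.bilin 1 (ε * a)) (S z) ((0 : E4 →L[ℝ] E4) (S z) + d)).bilinearComp S S + (Kerr.bilin 1 (ε * a) (S z)).bilinearComp ((0 : E4 →L[ℝ] E4).comp S) S + (Kerr.bilin 1 (ε * a) (S z)).bilinearComp S ((0 : E4 →L[ℝ] E4).comp S))) x (sharpAt (boostedKerrBilin L 0 (ε * M) (ε * a)) x (E4.dx 0)) e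
        - ricAt (boostedKerrBilin L 0 (ε * M) (ε * a)) x (sharpAt (boostedKerrBilin L 0 (ε * M) (ε * a)) x (E4.dx 0)) e := ⟨_, rfl⟩
  have cA : ContinuousAt ΦA 0 := by rw [hΦA]; exact bk_continuousAt_row L M a A 0 hx0 hx e
  have cd : ContinuousAt Φd 0 := by rw [hΦd]; exact bk_continuousAt_row L M a 0 d hx0 hx e
  have hid' : ∀ ε : ℝ, 0 < ε → ε < ε₀ → ΦA ε + ε * Φd ε = 0 := by
    intro ε hε hεlt
    rw [hΦA, hΦd]
    exact hid ε hε hεlt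
  -- limits along `ε → 0⁺`
  have h1 : Tendsto ΦA (𝓝[>] 0) (𝓝 (ΦA 0)) := cA.tendsto.mono_left nhdsWithin_le_nhds
  have h2 : Tendsto (fun ε : ℝ ↦ -(ε * Φd ε)) (𝓝[>] 0) (𝓝 (-(0 * Φd 0))) :=
    ((continuous_id.tendsto (0 : ℝ)).mul cd.tendsto).neg.mono_left nhdsWithin_le_nhds
  have hev : (fun ε : ℝ ↦ -(ε * Φd ε)) =ᶠ[𝓝[>] 0] ΦA := by
    filter_upwards [Ioo_mem_nhdsGT hε₀] with ε hε
    have h := hid' ε hε.1 hε.2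
    linarith
  have h3 : Tendsto ΦA (𝓝[>] 0) (𝓝 (-(0 * Φd 0))) := h2.congr' hev
  have h0 : ΦA 0 = 0 := by
    have h := tendsto_nhds_unique h1 h3
    rw [h]; ring
  rw [hΦA] at h0
  simp only [] at h0
  rw [bk_row_zero L M a A 0 x e] at h0
  exact h0

/-- **Registered carrier** `bk_limitRow_carrier` of the crux item (one-line form of
`bk_row_eq_ricciJet_field`, for the `--supports` protocol). [folklore] -/
theorem bk_limitRow_carrier : open Literature.Geometry.Lorentzian Literature.Geometry.Lorentzian.MetricCoord in ∀ {G Φ : E4 → E4 →L[ℝ] E4 →L[ℝ] ℝ} {V U : Set E4} {x : E4}, IsMetricOn G V → x ∈ V → x 0 = 0 → IsOpen U → ContDiffOn ℝ (⊤ : ℕ∞) Φ U → x ∈ U → (∀ z ∈ U, ∀ v w : E4, Φ z v w = Φ z w v) → ∀ (e : E4), (ricAt (fun z : E4 ↦ G z + (z 0) • Φ z) x (sharpAt G x (E4.dx 0)) e - ricAt G x (sharpAt G x (E4.dx 0)) e) = ricciJet (x, G x, fderiv ℝ G x + (E4.dx 0).smulRight (Φ x), fderiv ℝ (fderiv ℝ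 G) x + ((E4.dx 0).smulRight (fderiv ℝ Φ x) + (ContinuousLinearMap.smulRightL ℝ E4 (E4 →L[ℝ] E4 →L[ℝ] ℝ) (E4.dx 0)).comp (fderiv ℝ Φ x))) (sharpAt G x (E4.dx 0)) e - ricciJet (x, G x, fderiv ℝ G x, fderiv ℝ (fderiv ℝ G) x) (sharpAt G x (E4.dx 0)) e :=
  fun hG hxV hx0 hU hΦc hxU hΦs e ↦ bk_row_eq_ricciJet_field hG hxV hx0 hU hΦc hxU hΦs e

end Summit.FinalStateConjecture.FinalStateConjecture.Theorems.SublinearIsFree.Slaving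

end
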